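import Literature.Computation.Certificates.PosSemidefInt
import Literature.Computation.Certificates.Data
import Mathlib.Algebra.Order.Chebyshev

/-!
# PSD by a rounded twin: a low-height certificate for a high-height rational Gram block

Compute-infrastructure file (certnum L4 lane; gridfusion lever «L4-396», 2026-08-27). A rational
symmetric matrix `Q` whose entries have very large numerators/denominators (e.g. the 396 × 396
absorber block of gridfusion's dense NE39 certificate: 403-bit numerators over a 394-bit common
denominator) makes every exact integer-residual PSD lane (`IsGramCertZ` with weights of the size of
the common denominator) hours of kernel time. If `Q` is comfortably positive definite, Rump's
perturbation argument [cite: Rump1999VerifiedLargeSystems, §4 Algorithm 4.1 step 7] gives a cheap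
route: certify a ROUNDED TWIN instead and pay the rounding with an eigenvalue margin.

Concretely (all data exact): pick a scale `S > 0` (e.g. `2^12`), an integer matrix `C` (the emitter's
rounding of `S·Q`), an integer shift `s` and an entrywise tolerance `e` with

* `M := C − s·1` certified by ANY integer Gram certificate `PSD.IsGramCertZ M d B` (the packed lane
  `PackedGramRowsOfLists`, the ℤ-list lane `PosSemidefIntList`, …) — so `yᵀ C y ≥ s·‖y‖²`;
* `|S·Q i j − C i j| ≤ e` for all `i, j` — decided on list data by `PSD.closeCheckN` below, with ALL
  big-number arithmetic in `ℕ` (sign/magnitude by constructor matching; cf. the kernel cost note in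
  `PackedGramRowsOfLists.lean`);
* the margin `n·e ≤ s` (a comparison of two small naturals).

Then for every `y`, `S·yᵀQy = yᵀCy + yᵀ(SQ − C)y ≥ s‖y‖² − e·(Σ|y_i|)² ≥ (s − n e)‖y‖² ≥ 0`
(Cauchy–Schwarz `(Σ|y_i|)² ≤ n·Σ y_i²`), i.e. `Q` has nonnegative quadratic form — exactly the
`QuadNonneg` hypothesis shape consumed by `GramSOS.quadNonneg_of_gramCertZ`-style assembly, stated
here for `matrixOfRows n n Qrows` (the emitters' presentation).

Main declarations (namespace `Literature.Computation.Certificates.PSD`):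
* `quadForm_nonneg_of_near` — the abstract perturbation lemma over a linearly ordered field;
* `closeEntryN`, `closeCheckN` — the ℕ-arithmetic closeness checker on list data (its semantics
  lemma is file-private);
* **`quadForm_nonneg_of_roundedTwin`** — `IsGramCertZ (matrixOfRows n n Mrows) d B` (twin minus
  shift) + `closeCheckN n S s e Qrows Mrows = true` + `n * e ≤ s` ⇒
  `∀ y, 0 ≤ Σ_i Σ_j y_i · Q_ij · y_j` for `Q = matrixOfRows n n Qrows`, over any linearly ordered field.

Measured (certnum-sdp-3 `kernel/l396/`, farm, one `decide +kernel` each): for the 396-block above,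
`S = 2^12`, max `|Q − C/S| = 1.22·10⁻⁴` (so `e = 1` in units of `1/S` after rounding to nearest —
here `n·e = 396 ≤ s = 512`), `M = C − 512·1` DD-certified with a 29-bit integer factor; the packed
rows check at that shape runs in 158 s. WHAT THIS FILE DOES NOT CERTIFY: that a twin EXISTS (if `Q`
is nearly singular no shift `s ≥ n·e` works — use an exact lane); anything about `Q` beyond the
nonnegativity of its quadratic form (in particular no eigenvalue lower bound is exported, although
`(s − n e)/S` is one); the residual/identity side of an SOS certificate.

References: S. M. Rump, *Verified solution of large linear and nonlinear systems* (1999), §4,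
Algorithm 4.1 («if s − δ > 0 then A is positive definite», with δ ≥ ‖Δ‖) — the same inequality is
typed for certificate READERS, over `RCLike` fields with an `R`-factor built in, in
`DyadicCholResidualWitness.lean`; here the PSD premise is abstract and the data are lists, for KERNEL
evaluation. Diagonal dominance / Gram facts: [cite: BlekhermanParriloThomas2012, App. A.1.2].
-/

namespace Literature.Computation.Certificates

namespace PSD

open Finset

/-! ### The abstract perturbation lemma -/

section Perturbation

variable {R : Type*} [Field R] [LinearOrder R] [IsStrictOrderedRing R] {n : ℕ}

/-- **Quadratic-form perturbation**: if `yᵀ C y ≥ δ‖y‖²` for all `y`, `|A i j − C i j| ≤ ε`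
entrywise and `n·ε ≤ δ`, then `yᵀ A y ≥ 0` for all `y`
(since `|yᵀ(A − C)y| ≤ ε (Σ|y_i|)² ≤ n ε ‖y‖²` by Cauchy–Schwarz).
[cite: Rump1999VerifiedLargeSystems, §4 Algorithm 4.1 step 7] -/
theorem quadForm_nonneg_of_near (A C : Matrix (Fin n) (Fin n) R) {δ ε : R}
    (hC : ∀ y : Fin n → R, δ * ∑ i, y i ^ 2 ≤ ∑ i, ∑ j, y i * C i j * y j)
    (hE : ∀ i j, |A i j - C i j| ≤ ε) (hδ : (n : R) * ε ≤ δ) (y : Fin n → R) :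
    0 ≤ ∑ i, ∑ j, y i * A i j * y j := by
  -- split A = C + (A - C)
  have hsplit : ∑ i, ∑ j, y i * A i j * y j =
      (∑ i, ∑ j, y i * C i j * y j) + ∑ i, ∑ j, y i * (A i j - C i j) * y j := by
    rw [← Finset.sum_add_distrib]
    refine Finset.sum_congr rfl fun i _ => ?_
    rw [← Finset.sum_add_distrib]
    exact Finset.sum_congr rfl fun j _ => by ring
  -- the perturbation term is ≥ -ε (Σ |y_i|)²
  have hpert : -(ε * (∑ i, |y i|) ^ 2) ≤ ∑ i, ∑ j, y i * (A i j - C i j) * y j := by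
    have hterm : ∀ i j, -(ε * (|y i| * |y j|)) ≤ y i * (A i j - C i j) * y j := by
      intro i j
      have h1 : |y i * (A i j - C i j) * y j| ≤ ε * (|y i| * |y j|) := by
        rw [abs_mul, abs_mul]
        have := hE i j
        have hyi := abs_nonneg (y i); have hyj := abs_nonneg (y j)
        nlinarith [mul_nonneg hyi hyj]
      linarith [neg_abs_le (y i * (A i j - C i j) * y j)]
    calc -(ε * (∑ i, |y i|) ^ 2)
        = ∑ i, ∑ j, -(ε * (|y i| * |y j|)) := by
          rw [sq, Finset.sum_mul_sum, Finset.mul_sum, ← Finset.sum_neg_distrib]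
          refine Finset.sum_congr rfl fun i _ => ?_
          rw [Finset.mul_sum, ← Finset.sum_neg_distrib]
      _ ≤ ∑ i, ∑ j, y i * (A i j - C i j) * y j :=
          Finset.sum_le_sum fun i _ => Finset.sum_le_sum fun j _ => hterm i j
  -- Cauchy–Schwarz: (Σ |y_i|)² ≤ n Σ y_i²
  have hcs : (∑ i, |y i|) ^ 2 ≤ (n : R) * ∑ i, y i ^ 2 := by
    have h := Finset.sum_mul_sq_le_sq_mul_sq (Finset.univ : Finset (Fin n)) (fun i => |y i|) (fun _ => (1 : R))
    simp only [mul_one, one_pow, Finset.sum_const, Finset.card_univ, Fintype.card_fin,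
      nsmul_eq_mul, sq_abs] at h
    simpa [mul_comm] using h
  have hsq : 0 ≤ ∑ i, y i ^ 2 := Finset.sum_nonneg fun i _ => sq_nonneg (y i)
  rcases Nat.eq_zero_or_pos n with hn | hn
  · subst hn; simp
  · have hε : 0 ≤ ε := (abs_nonneg _).trans (hE ⟨0, hn⟩ ⟨0, hn⟩)
    have := hC y
    nlinarith [mul_le_mul_of_nonneg_left hcs hε]

end Perturbation

/-! ### The ℕ-arithmetic closeness checker on list data -/

/-- Sign and magnitude of an integer by constructor matching (no `Int` arithmetic). [folklore] -/
def sgnMag (z : ℤ) : Bool × ℕ :=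
  match z with
  | .ofNat k => (true, k)
  | .negSucc k => (false, k + 1)

/-- `sgnMag` semantics: the integer is `± magnitude`. [folklore] -/
private theorem sgnMag_spec (z : ℤ) :
    z = if (sgnMag z).1 then ((sgnMag z).2 : ℤ) else -((sgnMag z).2 : ℤ) := by
  cases z with
  | ofNat k => simp [sgnMag]
  | negSucc k => simp [sgnMag, Int.negSucc_eq]

/-- **Entry test** `|S·q − m'| ≤ e`, `m' = m + s·[i = j]`, with every big-number operation in `ℕ`:
writing `q = a/b`, it checks `|S·a − m'·b| ≤ e·b` by splitting `S·a − m'·b = P − N` into the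
nonnegative parts `P`, `N` according to the signs of `a` and `m'`. [folklore] -/
def closeEntryN (S s e i j : ℕ) (q : ℚ) (m : ℤ) : Bool :=
  let m' : ℤ := m + if i = j then (s : ℤ) else 0
  let a := sgnMag q.num
  let c := sgnMag m'
  let b := q.den
  let P := (if a.1 then S * a.2 else 0) + (if c.1 then 0 else c.2 * b)
  let N := (if a.1 then 0 else S * a.2) + (if c.1 then c.2 * b else 0)
  if N ≤ P then decide (P - N ≤ e * b) else decide (N - P ≤ e * b)

/-- Walk one row: entries `j, j+1, …` of the rational row against the integer row (fuel-indexed,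
sequential access, missing entries read as `0` exactly as `matrixOfRows` does). [folklore] -/
def closeRowN (S s e i : ℕ) : ℕ → ℕ → List ℚ → List ℤ → Bool
  | 0, _, _, _ => true
  | fuel + 1, j, qrow, mrow =>
      closeEntryN S s e i j (qrow.headD 0) (mrow.headD 0) && closeRowN S s e i fuel (j + 1) qrow.tail mrow.tail

/-- Walk the rows `i, i+1, …` (fuel-indexed). [folklore] -/
def closeRowsN (n S s e : ℕ) : ℕ → ℕ → List (List ℚ) → List (List ℤ) → Bool
  | 0, _, _, _ => true
  | fuel + 1, i, Qrows, Mrows =>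
      closeRowN S s e i n 0 (Qrows.headD []) (Mrows.headD []) &&
        closeRowsN n S s e fuel (i + 1) Qrows.tail Mrows.tail

/-- **The closeness check** on list data: `0 < S` and `|S·Q i j − (M i j + s·[i=j])| ≤ e` for all
`i, j < n`, where `Q = matrixOfRows n n Qrows`, `M = matrixOfRows n n Mrows`. Discharge by
`decide +kernel`. [folklore] -/
def closeCheckN (n S s e : ℕ) (Qrows : List (List ℚ)) (Mrows : List (List ℤ)) : Bool :=
  decide (0 < S) && closeRowsN n S s e n 0 Qrows Mrows

/-- `headD`/`tail` fuel walks read `List.getD`. [folklore] -/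
private theorem getD_add_eq {α : Type*} (l : List α) (dflt : α) (j t : ℕ) :
    (List.drop j l).getD t dflt = l.getD (j + t) dflt := by
  rw [List.getD_eq_getElem?_getD, List.getD_eq_getElem?_getD, List.getElem?_drop]

/-- Bookkeeping for the split `V = P − N` of the entry test. [folklore] -/
private theorem abs_le_of_split {P N E : ℕ} {V : ℤ} (hV : V = (P : ℤ) - (N : ℤ))
    (h : (if N ≤ P then decide (P - N ≤ E) else decide (N - P ≤ E)) = true) : |V| ≤ (E : ℤ) := by
  rw [hV, abs_le]
  split at h
  · rename_i hNP
    simp only [decide_eq_true_eq] at h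
    zify [hNP] at h
    constructor <;> linarith
  · rename_i hNP
    simp only [decide_eq_true_eq] at h
    rw [not_le] at hNP
    zify [hNP.le] at h
    constructor <;> linarith

/-- Semantics of the entry test (as a rational inequality). [folklore] -/
private theorem closeEntryN_spec {S s e i j : ℕ} {q : ℚ} {m : ℤ}
    (h : closeEntryN S s e i j q m = true) :
    |(S : ℚ) * q - ((m : ℚ) + if i = j then (s : ℚ) else 0)| ≤ e := by
  set m' : ℤ := m + if i = j then (s : ℤ) else 0 with hm'
  have hb : (0 : ℚ) < q.den := by exact_mod_cast q.den_pos
  -- the integer inequality |S a − m' b| ≤ e b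
  have key : |(S : ℤ) * q.num - m' * (q.den : ℤ)| ≤ (e : ℤ) * (q.den : ℤ) := by
    have ha := sgnMag_spec q.num
    have hc := sgnMag_spec m'
    simp only [closeEntryN] at h
    rw [← hm'] at h
    rcases hA : sgnMag q.num with ⟨sa, ka⟩
    rcases hCm : sgnMag m' with ⟨sc, kc⟩
    rw [hA] at h ha
    rw [hCm] at h hc
    have hEb : ((e * q.den : ℕ) : ℤ) = (e : ℤ) * (q.den : ℤ) := by push_cast; ring
    rw [← hEb]
    cases sa <;> cases sc <;>
      simp only [Bool.false_eq_true, ↓reduceIte, zero_add, add_zero] at h ha hc <;>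
      refine abs_le_of_split ?_ h <;> (rw [ha, hc]; push_cast; ring)
  -- back to ℚ
  have hm'q : ((m : ℚ) + if i = j then (s : ℚ) else 0) = (m' : ℚ) := by
    rw [hm']; push_cast; rfl
  rw [hm'q]
  have hrepr : (S : ℚ) * q - (m' : ℚ) = (((S : ℤ) * q.num - m' * (q.den : ℤ) : ℤ) : ℚ) / (q.den : ℚ) := by
    rw [eq_div_iff hb.ne']
    push_cast
    have hqd := Rat.mul_den_eq_num q
    rw [sub_mul, mul_assoc, hqd]
  rw [hrepr, abs_div, abs_of_pos hb, div_le_iff₀ hb]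
  exact_mod_cast key

/-- Semantics of the row walk. [folklore] -/
private theorem closeRowN_spec {S s e i : ℕ} :
    ∀ (fuel j : ℕ) (qrow : List ℚ) (mrow : List ℤ), closeRowN S s e i fuel j qrow mrow = true →
      ∀ t, t < fuel → closeEntryN S s e i (j + t) (qrow.getD t 0) (mrow.getD t 0) = true
  | 0, _, _, _, _, t, ht => by omega
  | fuel + 1, j, qrow, mrow, h, t, ht => by
      simp only [closeRowN, Bool.and_eq_true] at h
      cases t with
      | zero =>
          simpa [List.getD_eq_getElem?_getD, List.headD_eq_head?_getD, List.head?_eq_getElem?] using h.1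
      | succ t =>
          have ih := closeRowN_spec fuel (j + 1) qrow.tail mrow.tail h.2 t (by omega)
          simp only [List.getD_eq_getElem?_getD, List.getElem?_tail] at ih ⊢
          simpa [Nat.add_right_comm, Nat.add_assoc] using ih

/-- Semantics of the rows walk. [folklore] -/
private theorem closeRowsN_spec {n S s e : ℕ} :
    ∀ (fuel i : ℕ) (Qrows : List (List ℚ)) (Mrows : List (List ℤ)),
      closeRowsN n S s e fuel i Qrows Mrows = true →
      ∀ t, t < fuel → closeRowN S s e (i + t) n 0 (Qrows.getD t []) (Mrows.getD t []) = true
  | 0, _, _, _, _, t, ht => by omega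
  | fuel + 1, i, Qrows, Mrows, h, t, ht => by
      simp only [closeRowsN, Bool.and_eq_true] at h
      cases t with
      | zero =>
          simpa [List.getD_eq_getElem?_getD, List.headD_eq_head?_getD, List.head?_eq_getElem?] using h.1
      | succ t =>
          have ih := closeRowsN_spec fuel (i + 1) Qrows.tail Mrows.tail h.2 t (by omega)
          simp only [List.getD_eq_getElem?_getD, List.getElem?_tail] at ih ⊢
          simpa [Nat.add_right_comm, Nat.add_assoc] using ih

/-- **Semantics of `closeCheckN`** (file-private plumbing; the public interface is
`quadForm_nonneg_of_roundedTwin`). [folklore] -/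
private theorem closeCheckN_spec {n S s e : ℕ} {Qrows : List (List ℚ)} {Mrows : List (List ℤ)}
    (h : closeCheckN n S s e Qrows Mrows = true) :
    0 < S ∧ ∀ i j : Fin n,
      |(S : ℚ) * matrixOfRows n n Qrows i j -
          (((matrixOfRows n n Mrows i j : ℤ) : ℚ) + if i = j then (s : ℚ) else 0)| ≤ e := by
  simp only [closeCheckN, Bool.and_eq_true, decide_eq_true_eq] at h
  refine ⟨h.1, fun i j => ?_⟩
  have hrow := closeRowsN_spec n 0 Qrows Mrows h.2 i.val i.isLt
  have hent := closeRowN_spec n 0 _ _ hrow j.val j.isLt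
  simp only [Nat.zero_add] at hent
  have := closeEntryN_spec hent
  simpa [matrixOfRows, Fin.ext_iff] using this

/-! ### The rounded-twin certificate -/

section Twin

variable {R : Type*} [Field R] [LinearOrder R] [IsStrictOrderedRing R]

/-- **PSD by a rounded twin** (list data, kernel-evaluable hypotheses): an integer Gram certificate
for the shifted twin `M = C − s·1` (any lane producing `PSD.IsGramCertZ`), the ℕ-arithmetic
closeness check `|S·Q − C| ≤ e` entrywise, and the margin `n·e ≤ s` imply that the RATIONAL block
`Q = matrixOfRows n n Qrows` has nonnegative quadratic form over any linearly ordered field — the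
`QuadNonneg` hypothesis shape of the SOS assembly lemmas.
[cite: Rump1999VerifiedLargeSystems, §4 Algorithm 4.1 step 7] -/
theorem quadForm_nonneg_of_roundedTwin {n m S s e : ℕ} {Qrows : List (List ℚ)}
    {Mrows : List (List ℤ)} {d : Fin m → ℕ} {B : Matrix (Fin m) (Fin n) ℤ}
    (hM : IsGramCertZ (matrixOfRows n n Mrows) d B)
    (hclose : closeCheckN n S s e Qrows Mrows = true) (hmargin : n * e ≤ s) (y : Fin n → R) :
    0 ≤ ∑ i, ∑ j, y i * ((matrixOfRows n n Qrows i j : ℚ) : R) * y j := by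
  obtain ⟨hS, hE⟩ := closeCheckN_spec hclose
  let Q : Matrix (Fin n) (Fin n) R := fun i j => ((matrixOfRows n n Qrows i j : ℚ) : R)
  let C : Matrix (Fin n) (Fin n) R :=
    fun i j => ((matrixOfRows n n Mrows i j : ℤ) : R) + if i = j then (s : R) else 0
  -- (1) the twin: yᵀ C y = yᵀ M y + s ‖y‖² ≥ s ‖y‖²
  have hCform : ∀ z : Fin n → R, (s : R) * ∑ i, z i ^ 2 ≤ ∑ i, ∑ j, z i * C i j * z j := by
    intro z
    have h0 := hM.quadForm_nonneg (R := R) z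
    have hdiag : ∀ i : Fin n, ∑ j, z i * (if i = j then (s : R) else 0) * z j = (s : R) * z i ^ 2 := by
      intro i
      have : ∀ j : Fin n, z i * (if i = j then (s : R) else 0) * z j = if i = j then (s : R) * z i ^ 2 else 0 := by
        intro j; split
        · subst_vars; ring
        · ring
      simp_rw [this]
      simp
    have hsplit : ∑ i, ∑ j, z i * C i j * z j =
        (∑ i, ∑ j, z i * ((matrixOfRows n n Mrows i j : ℤ) : R) * z j) + (s : R) * ∑ i, z i ^ 2 := by
      rw [Finset.mul_sum, ← Finset.sum_add_distrib]
      refine Finset.sum_congr rfl fun i _ => ?_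
      rw [← hdiag i, ← Finset.sum_add_distrib]
      exact Finset.sum_congr rfl fun j _ => by simp only [C]; ring
    rw [hsplit]; linarith
  -- (2) closeness, cast to R: |(S • Q) − C| ≤ e entrywise
  have hEr : ∀ i j, |((S : R) • Q) i j - C i j| ≤ (e : R) := by
    intro i j
    have h := (Rat.cast_le (K := R)).mpr (hE i j)
    rw [Rat.cast_abs] at h
    have hcast : ((((S : ℚ) * matrixOfRows n n Qrows i j -
        (((matrixOfRows n n Mrows i j : ℤ) : ℚ) + if i = j then (s : ℚ) else 0) : ℚ)) : R) =
        ((S : R) • Q) i j - C i j := by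
      simp only [Q, C, Matrix.smul_apply, smul_eq_mul]
      split <;> push_cast <;> ring
    rw [hcast] at h
    exact_mod_cast h
  -- (3) perturbation lemma for A = S • Q, then divide by S > 0
  have hmarginR : (n : R) * (e : R) ≤ (s : R) := by exact_mod_cast hmargin
  have hSQ := quadForm_nonneg_of_near ((S : R) • Q) C hCform hEr hmarginR y
  have hscale : ∑ i, ∑ j, y i * ((S : R) • Q) i j * y j = (S : R) * ∑ i, ∑ j, y i * Q i j * y j := by
    rw [Finset.mul_sum]
    refine Finset.sum_congr rfl fun i _ => ?_
    rw [Finset.mul_sum]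
    exact Finset.sum_congr rfl fun j _ => by simp only [Matrix.smul_apply, smul_eq_mul]; ring
  rw [hscale] at hSQ
  have hSpos : (0 : R) < (S : R) := by exact_mod_cast hS
  show 0 ≤ ∑ i, ∑ j, y i * Q i j * y j
  exact (mul_nonneg_iff_of_pos_left hSpos).mp hSQ

end Twin

/-! ### Kernel-checked example -/

/-- Test: `Q = [[2.0001, -1], [-1, 2.0001]]`-ish with huge denominators (`1/3^40` noise), twin
`C = round(4·Q) = [[8,-4],[-4,8]]`, shift `s = 2`, `M = C − 2·1 = [[6,-4],[-4,6]]` certified by the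
integer Gram certificate `d = [2, 1]`, `B = [[1,-2],[?]]`… here simply `M = Bᵀ diag(d) B + DD` with
`B = [[1, -1], [0, 1]]`, `d = [4, 2]` (residual `[[2,0],[0,0]]`); closeness `e = 1`, `n·e = 2 ≤ s`. -/
example : closeCheckN 2 4 2 1
    [[(2 : ℚ) + 1 / 3 ^ 40, -1], [-1, (2 : ℚ) - 1 / 3 ^ 40]] [[6, -4], [-4, 6]] = true := by
  decide +kernel

example : IsGramCertZ (matrixOfRows 2 2 [[6, -4], [-4, 6]]) ![4, 2] !![1, -1; 0, 1] := by
  decide +kernel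

example (y : Fin 2 → ℝ) :
    0 ≤ ∑ i, ∑ j, y i * ((matrixOfRows 2 2 [[(2 : ℚ) + 1 / 3 ^ 40, -1], [-1, (2 : ℚ) - 1 / 3 ^ 40]] i j : ℚ) : ℝ) * y j :=
  quadForm_nonneg_of_roundedTwin (R := ℝ) (S := 4) (s := 2) (e := 1)
    (Qrows := [[(2 : ℚ) + 1 / 3 ^ 40, -1], [-1, (2 : ℚ) - 1 / 3 ^ 40]]) (Mrows := [[6, -4], [-4, 6]])
    (d := ![4, 2]) (B := !![1, -1; 0, 1]) (by decide +kernel) (by decide +kernel) (by decide) y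

/-! ### Row-range (chunked) closeness — APPEND (certnum-sdp-3, 2026-08-27)

Measured: one `closeCheckN` decide handles ≈ 40 000 entries in ≈ 70 s (n = 200) but a 396 × 396
block (157 000 entries of 400-bit rationals) does not complete in one kernel call on the farm. The
closeness test is entrywise, so it splits by ROW RANGES with no mathematics: `closeRangeN … lo k`
checks rows `lo, …, lo+k−1`; `quadForm_nonneg_of_roundedTwin_ranges` assembles `m` ranges
`[c·k, c·k+k)` covering `0 … n−1` (side condition `n ≤ m·k`), each range its own `decide` (in its own
file if needed). -/

/-- Closeness of the ROWS `lo … lo+k−1` only (same entry test, same defaults as `closeCheckN`).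
[folklore] -/
def closeRangeN (n S s e lo k : ℕ) (Qrows : List (List ℚ)) (Mrows : List (List ℤ)) : Bool :=
  closeRowsN n S s e k lo (Qrows.drop lo) (Mrows.drop lo)

/-- Semantics of a row range. [folklore] -/
private theorem closeRangeN_spec {n S s e lo k : ℕ} {Qrows : List (List ℚ)} {Mrows : List (List ℤ)}
    (h : closeRangeN n S s e lo k Qrows Mrows = true) :
    ∀ i j : Fin n, lo ≤ i.val → i.val < lo + k →
      |(S : ℚ) * matrixOfRows n n Qrows i j -
          (((matrixOfRows n n Mrows i j : ℤ) : ℚ) + if i = j then (s : ℚ) else 0)| ≤ e := by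
  intro i j hlo hhi
  obtain ⟨t, ht⟩ : ∃ t, i.val = lo + t := ⟨i.val - lo, by omega⟩
  have htk : t < k := by omega
  have hrow := closeRowsN_spec (n := n) (S := S) (s := s) (e := e) k lo (Qrows.drop lo) (Mrows.drop lo) h t htk
  rw [getD_add_eq, getD_add_eq] at hrow
  have hent := closeRowN_spec n 0 _ _ hrow j.val j.isLt
  simp only [Nat.zero_add] at hent
  have := closeEntryN_spec hent
  rw [← ht] at this
  simpa [matrixOfRows, Fin.ext_iff] using this

section TwinRanges

variable {R : Type*} [Field R] [LinearOrder R] [IsStrictOrderedRing R]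

/-- **PSD by a rounded twin, closeness as a PROPOSITION** (the lane's internal interface: any way of
establishing the entrywise bound feeds it). [cite: Rump1999VerifiedLargeSystems, §4 Algorithm 4.1 step 7] -/
theorem quadForm_nonneg_of_roundedTwin_of_close {n m S s e : ℕ} {Qrows : List (List ℚ)}
    {Mrows : List (List ℤ)} {d : Fin m → ℕ} {B : Matrix (Fin m) (Fin n) ℤ}
    (hM : IsGramCertZ (matrixOfRows n n Mrows) d B) (hS : 0 < S)
    (hE : ∀ i j : Fin n, |(S : ℚ) * matrixOfRows n n Qrows i j -
          (((matrixOfRows n n Mrows i j : ℤ) : ℚ) + if i = j then (s : ℚ) else 0)| ≤ e)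
    (hmargin : n * e ≤ s) (y : Fin n → R) :
    0 ≤ ∑ i, ∑ j, y i * ((matrixOfRows n n Qrows i j : ℚ) : R) * y j := by
  let Q : Matrix (Fin n) (Fin n) R := fun i j => ((matrixOfRows n n Qrows i j : ℚ) : R)
  let C : Matrix (Fin n) (Fin n) R :=
    fun i j => ((matrixOfRows n n Mrows i j : ℤ) : R) + if i = j then (s : R) else 0
  have hCform : ∀ z : Fin n → R, (s : R) * ∑ i, z i ^ 2 ≤ ∑ i, ∑ j, z i * C i j * z j := by
    intro z
    have h0 := hM.quadForm_nonneg (R := R) z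
    have hdiag : ∀ i : Fin n, ∑ j, z i * (if i = j then (s : R) else 0) * z j = (s : R) * z i ^ 2 := by
      intro i
      have : ∀ j : Fin n, z i * (if i = j then (s : R) else 0) * z j = if i = j then (s : R) * z i ^ 2 else 0 := by
        intro j; split
        · subst_vars; ring
        · ring
      simp_rw [this]
      simp
    have hsplit : ∑ i, ∑ j, z i * C i j * z j =
        (∑ i, ∑ j, z i * ((matrixOfRows n n Mrows i j : ℤ) : R) * z j) + (s : R) * ∑ i, z i ^ 2 := by
      rw [Finset.mul_sum, ← Finset.sum_add_distrib]
      refine Finset.sum_congr rfl fun i _ => ?_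
      rw [← hdiag i, ← Finset.sum_add_distrib]
      exact Finset.sum_congr rfl fun j _ => by simp only [C]; ring
    rw [hsplit]; linarith
  have hEr : ∀ i j, |((S : R) • Q) i j - C i j| ≤ (e : R) := by
    intro i j
    have h := (Rat.cast_le (K := R)).mpr (hE i j)
    rw [Rat.cast_abs] at h
    have hcast : ((((S : ℚ) * matrixOfRows n n Qrows i j -
        (((matrixOfRows n n Mrows i j : ℤ) : ℚ) + if i = j then (s : ℚ) else 0) : ℚ)) : R) =
        ((S : R) • Q) i j - C i j := by
      simp only [Q, C, Matrix.smul_apply, smul_eq_mul]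
      split <;> push_cast <;> ring
    rw [hcast] at h
    exact_mod_cast h
  have hmarginR : (n : R) * (e : R) ≤ (s : R) := by exact_mod_cast hmargin
  have hSQ := quadForm_nonneg_of_near ((S : R) • Q) C hCform hEr hmarginR y
  have hscale : ∑ i, ∑ j, y i * ((S : R) • Q) i j * y j = (S : R) * ∑ i, ∑ j, y i * Q i j * y j := by
    rw [Finset.mul_sum]
    refine Finset.sum_congr rfl fun i _ => ?_
    rw [Finset.mul_sum]
    exact Finset.sum_congr rfl fun j _ => by simp only [Matrix.smul_apply, smul_eq_mul]; ring
  rw [hscale] at hSQ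
  have hSpos : (0 : R) < (S : R) := by exact_mod_cast hS
  show 0 ≤ ∑ i, ∑ j, y i * Q i j * y j
  exact (mul_nonneg_iff_of_pos_left hSpos).mp hSQ

/-- **PSD by a rounded twin, CHUNKED closeness**: `m` row ranges `[c·k, c·k + k)` with `n ≤ m·k`,
each range checked by its own `decide +kernel` (≈ 70 s per 40 000 entries of 400-bit rationals;
split further across files if needed), replace the single `closeCheckN`.
[cite: Rump1999VerifiedLargeSystems, §4 Algorithm 4.1 step 7] -/
theorem quadForm_nonneg_of_roundedTwin_ranges {n m S s e k mch : ℕ} {Qrows : List (List ℚ)}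
    {Mrows : List (List ℤ)} {d : Fin m → ℕ} {B : Matrix (Fin m) (Fin n) ℤ}
    (hM : IsGramCertZ (matrixOfRows n n Mrows) d B) (hS : 0 < S)
    (hranges : ∀ c : Fin mch, closeRangeN n S s e (c.val * k) k Qrows Mrows = true)
    (hcover : n ≤ mch * k) (hmargin : n * e ≤ s) (y : Fin n → R) :
    0 ≤ ∑ i, ∑ j, y i * ((matrixOfRows n n Qrows i j : ℚ) : R) * y j := by
  refine quadForm_nonneg_of_roundedTwin_of_close hM hS (fun i j => ?_) hmargin y
  have hk : 0 < k := by
    rcases Nat.eq_zero_or_pos k with hk | hk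
    · subst hk; have := i.isLt; omega
    · exact hk
  have hc : i.val / k < mch := by
    by_contra hnot
    rw [not_lt] at hnot
    have h1 : mch * k ≤ (i.val / k) * k := Nat.mul_le_mul_right k hnot
    have h2 : (i.val / k) * k ≤ i.val := Nat.div_mul_le_self i.val k
    have := i.isLt; omega
  refine closeRangeN_spec (hranges ⟨i.val / k, hc⟩) i j ?_ ?_
  · exact Nat.div_mul_le_self i.val k
  · have := Nat.lt_div_mul_add hk (a := i.val)
    simpa [Nat.mul_comm] using this

end TwinRanges

/-- Test (chunked form): the `2 × 2` example above with two one-row ranges. -/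
example (y : Fin 2 → ℝ) :
    0 ≤ ∑ i, ∑ j, y i * ((matrixOfRows 2 2 [[(2 : ℚ) + 1 / 3 ^ 40, -1], [-1, (2 : ℚ) - 1 / 3 ^ 40]] i j : ℚ) : ℝ) * y j :=
  quadForm_nonneg_of_roundedTwin_ranges (R := ℝ) (S := 4) (s := 2) (e := 1) (k := 1) (mch := 2)
    (Qrows := [[(2 : ℚ) + 1 / 3 ^ 40, -1], [-1, (2 : ℚ) - 1 / 3 ^ 40]]) (Mrows := [[6, -4], [-4, 6]])
    (d := ![4, 2]) (B := !![1, -1; 0, 1]) (by decide +kernel) (by decide)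
    (by intro c; fin_cases c <;> decide +kernel) (by decide) (by decide) y

end PSD

end Literature.Computation.Certificates
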